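import Summits.RiemannHypothesis.RiemannHypothesis.Theorems.WeilTwoPrimeDeflC83XBase
import Literature.NumberTheory.LFunctions.WeilBlockRows
import HarnessLib

/-!
# Deflated two-prime certificate C83X: rows 16–23 of the even check `D C = I`

`WeilCert.checkDCRow 0` for certificate C83X, by `decide +kernel`. Pure proof file.
-/

set_option linter.dupNamespace false

noncomputable section

namespace Summit.RiemannHypothesis.RiemannHypothesis.Theorems.EvenWinsBeyondArch

open Literature.NumberTheory.LFunctions

set_option maxHeartbeats 0 in
/-- Kernel check of row 16 of the even `D C = I` (certificate C83X). [folklore] -/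
theorem checkDCRow0_16_weilCertDeflC83X : weilCertDeflC83XBase.checkDCRow 0 16 = true := by
  decide +kernel

set_option maxHeartbeats 0 in
/-- Kernel check of row 17 of the even `D C = I` (certificate C83X). [folklore] -/
theorem checkDCRow0_17_weilCertDeflC83X : weilCertDeflC83XBase.checkDCRow 0 17 = true := by
  decide +kernel

set_option maxHeartbeats 0 in
/-- Kernel check of row 18 of the even `D C = I` (certificate C83X). [folklore] -/
theorem checkDCRow0_18_weilCertDeflC83X : weilCertDeflC83XBase.checkDCRow 0 18 = true := by
  decide +kernel

set_option maxHeartbeats 0 in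
/-- Kernel check of row 19 of the even `D C = I` (certificate C83X). [folklore] -/
theorem checkDCRow0_19_weilCertDeflC83X : weilCertDeflC83XBase.checkDCRow 0 19 = true := by
  decide +kernel

set_option maxHeartbeats 0 in
/-- Kernel check of row 20 of the even `D C = I` (certificate C83X). [folklore] -/
theorem checkDCRow0_20_weilCertDeflC83X : weilCertDeflC83XBase.checkDCRow 0 20 = true := by
  decide +kernel

set_option maxHeartbeats 0 in
/-- Kernel check of row 21 of the even `D C = I` (certificate C83X). [folklore] -/
theorem checkDCRow0_21_weilCertDeflC83X : weilCertDeflC83XBase.checkDCRow 0 21 = true := by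
  decide +kernel

set_option maxHeartbeats 0 in
/-- Kernel check of row 22 of the even `D C = I` (certificate C83X). [folklore] -/
theorem checkDCRow0_22_weilCertDeflC83X : weilCertDeflC83XBase.checkDCRow 0 22 = true := by
  decide +kernel

set_option maxHeartbeats 0 in
/-- Kernel check of row 23 of the even `D C = I` (certificate C83X). [folklore] -/
theorem checkDCRow0_23_weilCertDeflC83X : weilCertDeflC83XBase.checkDCRow 0 23 = true := by
  decide +kernel


end Summit.RiemannHypothesis.RiemannHypothesis.Theorems.EvenWinsBeyondArch
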